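import Summits.NavierStokesRegularity.NavierStokesRegularity.Theses.ConservativeEngine
import Summits.NavierStokesRegularity.NavierStokesRegularity.Theorems.EulerZoomLiouvilleConservativeZoomReduction

/-!
# N30 «CONSERVATIVE ENGINE» — support item Zᶜ `ConservativeZoomReduction` CLOSED by the banked kernel theorem

The route item `ConservativeEngine.ConservativeZoomReduction` (stmt 27530) is, up to unfolding the item text,
`Theorems.ConservativeEngine.conservativeZoomReduction_proof` (p779406; lens-6 g18 §3: the tree's Z-proof with the local energy
EQUALITY threaded through the vanishing-viscosity limit).  Sources: Seregin 2026 Thm 3.1; arXiv:2507.08733 p.5; CKN 1982 §2;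
Duchon–Robert 2000 §4.
-/

namespace Summit.NavierStokesRegularity.NavierStokesRegularity.Theorems

/-- **Zᶜ** — the route item `ConservativeEngine.ConservativeZoomReduction`, from `conservativeZoomReduction_proof`. -/
theorem conservativeEngine_conservativeZoomReduction_proof : Theses.ConservativeEngine.ConservativeZoomReduction :=
  ConservativeEngine.conservativeZoomReduction_proof

end Summit.NavierStokesRegularity.NavierStokesRegularity.Theorems
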